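import Summits.ResolutionOfSingularities.ResolutionOfSingularities.Theorems.EquisingularLiftEquisingularLiftNatEquinodalCoreSOfCores2
import Summits.ResolutionOfSingularities.ResolutionOfSingularities.Theorems.EquisingularLiftEquisingularLiftNatEquinodalSectionFrame
import Summits.ResolutionOfSingularities.ResolutionOfSingularities.Theorems.EquisingularLiftEquisingularLiftNatEquinodalNodeChartStalk
import Summits.ResolutionOfSingularities.ResolutionOfSingularities.Theorems.EquisingularLiftEquisingularLiftNatEquinodalNodeChart
import Summits.ResolutionOfSingularities.ResolutionOfSingularities.Theorems.EquisingularLiftEquisingularLiftNatCompleteIntersectionLiftProj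
import Literature.AlgebraicGeometry.Resolution.AlterationsSections
import HarnessLib

/-!
# [OURS · L1 W4.5(b) · EL♮(3) · door ν4, brick N-0 (JINIT), `cores₂` conjunct S8] ★ `coreS8_splitNode` — CORE S8 PROVED:
# every node section `𝔰 i = [av i]` of the equinodal nose is an ORDINARY NODE ALONG THE SECTION inside the host plane,
# `SplitNodeAt ℙ³_O 𝓛₀ 𝓦₀ (ker 𝔰 i) (𝔰 i 𝔪)`

res-L1-w45b-stub-4 g13 (desk WORD g25-5 default / g25-6 of record: core S8 = stub-4).  STATEMENT = the `cores` binder list of res-L1-w45b-nose-w1's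
✓ `coreS_of_cores₂` (`…NatEquinodalCoreSOfCores2`, `(cores :` dropped) VERBATIM ⊢ its fourth conjunct (S8) VERBATIM.  DEF-FREE; no `sorry`; standard
axioms.  `--supports stmt-ResolutionOfSingularities-20148 --as helper`, counted 0.  EL♮(3) is NOT proved; resolution of singularities in positive
characteristic is NOT proved; nothing of [Hironaka2017] is asserted.

PROOF (at `x = 𝔰ᵢ(𝔪) ∈ D₊(x_d)`, `d = dv i`, `a = av i`, `u · a = B̃ · nᵢ`; `Θ` = germ ∘ `awayToSection`):
* `u := Θ((y₀ − n₀y₂)/x_d)`, `v := Θ((y₁ − n₁y₂)/x_d)`, `g := Θ(Ĝ/x_d^e)` with `y_t = Σ_j Ñ_{tj} x_{r j}` the hyperplane coordinates, `Ĝ = G̃(y)`;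
* `(ker 𝔰ᵢ)ₓ = 𝓛₀ₓ ⊔ (u, v)`: ✓ `SectionOfVec.stalkIdeal_ker_sectionOfVec_eq` (p686535; `𝔰ᵢ` is a closed immersion — a section of the separated `q`,
  ✓ S1 + Literature `isClosedImmersion_of_comp_eq_id`) + ✓ `SectionFrame.span_X_sub_eq_span_frame` (p686963) + ✓ `CILift.stalkIdeal_projIdealSheaf_span`;
* `𝓦₀ₓ = 𝓛₀ₓ ⊔ (g)`: ✓ `CILift.stalkIdeal_projIdealSheaf_span`;
* `g = a u² + b uv + c v² + h`, `h ∈ (u,v)³ ≤ 𝓛₀ₓ ⊔ (u,v)³`, `b² − 4ac` a unit: ✓ `SectionOfVec.mk₁_aeval_linear_eq_eval₂` (dehomogenisation commutes with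
  `G̃ ↦ G̃(y)`) + ✓ `SectionOfVec.node_taylor_eval₂` over ✓ `nodeChart_hypotheses`, the unit `Θ(y₂/x_d)` being detected by the LOCAL stalk map of `𝔰ᵢ`
  (✓ `SectionOfVec.stalkMap_germ_awayToSection`: it maps to `toStalk (y₂(a))`, and `u · y₂(a) = n₂ = 1`). [folklore assembly; OURS]
-/

set_option linter.dupNamespace false -- mandated namespace `Summit.<Summit>.<Problem>` of this single-conjunct summit
set_option linter.overlappingInstances false -- signatures carry `[IsDomain O] [IsDiscreteValuationRing O]`

noncomputable section

open CategoryTheory CategoryTheory.Limits AlgebraicGeometry TopologicalSpace Topology IsLocalRing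
open MvPolynomial HomogeneousLocalization
open Literature.AlgebraicGeometry.Resolution
open AlgebraicGeometry.Scheme.IdealSheafData
open Summit.ResolutionOfSingularities.ResolutionOfSingularities.Theses.EquisingularLift.Split
open Summit.ResolutionOfSingularities.ResolutionOfSingularities.Cruxes.EquisingularLift.StrataSplit

namespace Summit.ResolutionOfSingularities.ResolutionOfSingularities.Cruxes.EquisingularLiftNat.Sections.Equinodal

/-- congruence of the dehomogenised fraction in both the degree and the numerator. [folklore] -/
theorem SectionOfVec.mk₁_congr₂ {R : Type} [CommRing R] {n : ℕ} (d : Fin (n + 1)) {m m' : ℕ} {a b : MvPolynomial (Fin (n + 1)) R}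
    (hm : m = m') (h : a = b) (ha : a ∈ MvPolynomial.homogeneousSubmodule (Fin (n + 1)) R m)
    (hb : b ∈ MvPolynomial.homogeneousSubmodule (Fin (n + 1)) R m') :
    letI := MvPolynomial.gradedAlgebra (σ := Fin (n + 1)) (R := R)
    mk₁ (MvPolynomial.homogeneousSubmodule (Fin (n + 1)) R) (MvPolynomial.isHomogeneous_X R d) m a ha =
      mk₁ (MvPolynomial.homogeneousSubmodule (Fin (n + 1)) R) (MvPolynomial.isHomogeneous_X R d) m' b hb := by
  subst hm; subst h; rfl

set_option maxHeartbeats 400000 in -- the `cores₂` binder list (55 lines, ~2400 tokens) makes every `whnf` of the goal expensive; 200k fails at the statement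
/-- ★ **CORE S8 of `cores₂` — `SplitNodeAt ℙ³_O 𝓛₀ 𝓦₀ (ker 𝔰 i) (𝔰 i 𝔪)` for every node section.**  Binders = the `cores` hypothesis of
✓ `coreS_of_cores₂` verbatim.  See the module docstring for the proof. [OURS · brick N-0 · core S8; counted 0] -/
theorem coreS8_splitNode (k : Type) [Field k] [IsAlgClosed k] :
    ∀ (O : Type) [CommRing O] [IsDomain O] [IsDiscreteValuationRing O] [IsAdicComplete (IsLocalRing.maximalIdeal O) O]
        [IsAlgClosed (IsLocalRing.ResidueField O)] (θ : O →+* k), Function.Surjective θ →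
      (letI := MvPolynomial.gradedAlgebra (σ := Fin (3 + 1)) (R := O); letI := MvPolynomial.gradedAlgebra (σ := Fin (3 + 1)) (R := k);
       ∀ (φ : MvPolynomial.homogeneousSubmodule (Fin (3 + 1)) O →+*ᵍ MvPolynomial.homogeneousSubmodule (Fin (3 + 1)) k)
        (hφ' : HomogeneousIdeal.irrelevant (MvPolynomial.homogeneousSubmodule (Fin (3 + 1)) k) ≤ (HomogeneousIdeal.irrelevant (MvPolynomial.homogeneousSubmodule (Fin (3 + 1)) O)).map φ), (∀ s, φ s = MvPolynomial.map θ s) →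
        AlgebraicGeometry.IsIntegral (AlgebraicGeometry.Proj (MvPolynomial.homogeneousSubmodule (Fin (3 + 1)) O)) → IsLocallyNoetherian (AlgebraicGeometry.Proj (MvPolynomial.homogeneousSubmodule (Fin (3 + 1)) O)) → Literature.AlgebraicGeometry.Resolution.Scheme.IsRegular (AlgebraicGeometry.Proj (MvPolynomial.homogeneousSubmodule (Fin (3 + 1)) O)) → AlgebraicGeometry.IsProper (AlgebraicGeometry.Proj.toSpecZero (MvPolynomial.homogeneousSubmodule (Fin (3 + 1)) O) ≫ AlgebraicGeometry.Spec.map (CommRingCat.ofHom (algebraMap O (MvPolynomial.homogeneousSubmodule (Fin (3 + 1)) O 0)))) → AlgebraicGeometry.SmoothOfRelativeDimension 3 (AlgebraicGeometry.Proj.toSpecZero (MvPolynomial.homogeneousSubmodule (Fin (3 + 1)) O) ≫ AlgebraicGeometry.Spec.map (CommRingCat.ofHom (algebraMap O (MvPolynomial.homogeneousSubmodule (Fin (3 + 1)) O 0)))) →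
      -- the door's `ℓ`, `Z` and the CERTIFICATE data (`EqCertAt₀ k 3 ℓ Z hZ` unpacked)
      ∀ (ℓ : MvPolynomial (Fin (3 + 1)) k) (Z : Set (Literature.AlgebraicGeometry.Motives.projectiveSpace 3 k).left) (hZ : IsClosed Z) (e δ : ℕ) (g : MvPolynomial (Fin (3 + 1)) k)
        (B : Fin (3 + 1) → Fin 3 → k) (c a b : Fin 3) (v : Fin δ → Fin 3 → k) (r : Fin 3 → Fin (3 + 1)),
        g.IsHomogeneous e → Squarefree (restrictToHyperplane B g) →
        Z = {y : (Literature.AlgebraicGeometry.Motives.projectiveSpace 3 k).left | ℓ ∈ (y : ProjectiveSpectrum (MvPolynomial.homogeneousSubmodule (Fin (3 + 1)) k)).asHomogeneousIdeal ∧ g ∈ (y : ProjectiveSpectrum (MvPolynomial.homogeneousSubmodule (Fin (3 + 1)) k)).asHomogeneousIdeal} →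
        restrictToHyperplane B ℓ = 0 → Function.Injective r → ((c : ℕ) = 2 ∧ (a : ℕ) = 0 ∧ (b : ℕ) = 1) →
        (∀ i, v i c = 1 ∧ MvPolynomial.eval (v i) (restrictToHyperplane B g) = 0 ∧
          (∀ j, MvPolynomial.eval (v i) (MvPolynomial.pderiv j (restrictToHyperplane B g)) = 0) ∧ hessBlock (restrictToHyperplane B g) a b (v i) ≠ 0) →
        (∀ z : ↥(redSub (Literature.AlgebraicGeometry.Motives.projectiveSpace 3 k).left Z hZ), IsClosed ({z} : Set ↥(redSub (Literature.AlgebraicGeometry.Motives.projectiveSpace 3 k).left Z hZ)) → ¬ IsRegularLocalRing ((redSub (Literature.AlgebraicGeometry.Motives.projectiveSpace 3 k).left Z hZ).presheaf.stalk z) →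
          ∃ i, IsCoordVecOf k 3 (fun s => ∑ j, B s j * v i j) (redSubι (Literature.AlgebraicGeometry.Motives.projectiveSpace 3 k).left Z hZ z : (Literature.AlgebraicGeometry.Motives.projectiveSpace 3 k).left)) →
        Function.Injective v →
      -- the LIFTED HYPERPLANE data (✓ `HyperplaneLift.exists_hyperplane_lift`)
      ∀ (a₀ : Fin (3 + 1)) (Bt : Fin (3 + 1) → Fin 3 → O) (ct : Fin (3 + 1) → O) (Nt : Fin 3 → Fin 3 → O),
        (∀ j, r j ≠ a₀) → (∀ a' j, θ (Bt a' j) = B a' j) → IsUnit (Matrix.of fun j j' : Fin 3 => Bt (r j) j').det → ct a₀ = 1 →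
        MvPolynomial.aeval (fun a' : Fin (3 + 1) => ∑ j : Fin 3, MvPolynomial.C (Bt a' j) * MvPolynomial.X j) (∑ a, MvPolynomial.C (ct a) * MvPolynomial.X a : MvPolynomial (Fin (3 + 1)) O) = 0 →
        (∀ G : MvPolynomial (Fin 3) O, MvPolynomial.aeval (fun a' : Fin (3 + 1) => ∑ j : Fin 3, MvPolynomial.C (Bt a' j) * MvPolynomial.X j)
          (MvPolynomial.aeval (fun i : Fin 3 => ∑ j : Fin 3, MvPolynomial.C (Nt i j) * MvPolynomial.X (r j)) G) = G) →
        (∀ f : MvPolynomial (Fin (3 + 1)) O, MvPolynomial.aeval (fun a' : Fin (3 + 1) => ∑ j : Fin 3, MvPolynomial.C (Bt a' j) * MvPolynomial.X j) f = 0 → (∑ a, MvPolynomial.C (ct a) * MvPolynomial.X a : MvPolynomial (Fin (3 + 1)) O) ∣ f) →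
        {y : (Literature.AlgebraicGeometry.Motives.projectiveSpace 3 k).left | ℓ ∈ (y : ProjectiveSpectrum (MvPolynomial.homogeneousSubmodule (Fin (3 + 1)) k)).asHomogeneousIdeal} = {y : (Literature.AlgebraicGeometry.Motives.projectiveSpace 3 k).left | (∑ a', MvPolynomial.C (θ (ct a')) * MvPolynomial.X a' : MvPolynomial (Fin (3 + 1)) k) ∈ (y : ProjectiveSpectrum (MvPolynomial.homogeneousSubmodule (Fin (3 + 1)) k)).asHomogeneousIdeal} →
      -- the EQUINODAL LIFT (✓ `exists_equinodal_lift_of_cert_of_surjective`)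
      ∀ (Gt : MvPolynomial (Fin 3) O) (nO : Fin δ → Fin 3 → O),
        Gt.IsHomogeneous e → MvPolynomial.map θ Gt = restrictToHyperplane B g → (∀ i j, θ (nO i j) = v i j) → (∀ i, nO i 2 = 1) →
        (∀ i, MvPolynomial.eval (nO i) Gt = 0 ∧ ∀ j, MvPolynomial.eval (nO i) (MvPolynomial.pderiv j Gt) = 0) →
        (∀ i, IsUnit (MvPolynomial.eval (nO i) (MvPolynomial.pderiv 0 (MvPolynomial.pderiv 0 Gt)) * MvPolynomial.eval (nO i) (MvPolynomial.pderiv 1 (MvPolynomial.pderiv 1 Gt))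
          - MvPolynomial.eval (nO i) (MvPolynomial.pderiv 0 (MvPolynomial.pderiv 1 Gt)) ^ 2)) →
      -- the two models' degree certificates (so the ideal sheaves below are well-formed)
      ∀ (hL : ∀ l, (![(∑ a, MvPolynomial.C (ct a) * MvPolynomial.X a : MvPolynomial (Fin (3 + 1)) O)] : Fin 1 → MvPolynomial (Fin (3 + 1)) O) l ∈ MvPolynomial.homogeneousSubmodule (Fin (3 + 1)) O ((![1] : Fin 1 → ℕ) l))
        (hF : ∀ l, (![(∑ a, MvPolynomial.C (ct a) * MvPolynomial.X a : MvPolynomial (Fin (3 + 1)) O), (MvPolynomial.aeval (fun i : Fin 3 => ∑ j : Fin 3, MvPolynomial.C (Nt i j) * MvPolynomial.X (r j)) Gt : MvPolynomial (Fin (3 + 1)) O)] : Fin 2 → MvPolynomial (Fin (3 + 1)) O) l ∈ MvPolynomial.homogeneousSubmodule (Fin (3 + 1)) O ((![1, e] : Fin 2 → ℕ) l)),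
      -- the NODE SECTIONS `𝔰 i = [av i]`, `av i = uᵢ⁻¹ • B̃·nO i` (✓ SectionOfVec), and the marked closed points `w i`
      ∀ (av : Fin δ → Fin (3 + 1) → O) (dv : Fin δ → Fin (3 + 1)) (hav : ∀ i, av i (dv i) = 1),
        (∀ i, ∃ u : O, IsUnit u ∧ ∀ a', u * av i a' = ∑ j : Fin 3, Bt a' j * nO i j) →
      ∀ (𝔰 : Fin δ → (AlgebraicGeometry.Spec (.of O) ⟶ (AlgebraicGeometry.Proj (MvPolynomial.homogeneousSubmodule (Fin (3 + 1)) O)))),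
        (∀ i, 𝔰 i = (AlgebraicGeometry.Spec.map (CommRingCat.ofHom ((Localization.awayLift (MvPolynomial.eval (av i)) (MvPolynomial.X (dv i) : MvPolynomial (Fin (3 + 1)) O)
            (SectionOfVec.isUnit_eval_X (av i) (dv i) (hav i))).comp
          (algebraMap (HomogeneousLocalization.Away (MvPolynomial.homogeneousSubmodule (Fin (3 + 1)) O) (MvPolynomial.X (dv i) : MvPolynomial (Fin (3 + 1)) O))
            (Localization.Away (MvPolynomial.X (dv i) : MvPolynomial (Fin (3 + 1)) O))))) ≫
          AlgebraicGeometry.Proj.awayι (MvPolynomial.homogeneousSubmodule (Fin (3 + 1)) O) (MvPolynomial.X (dv i)) (MvPolynomial.isHomogeneous_X O (dv i)) one_pos)) →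
      ∀ (w : Fin δ → (Literature.AlgebraicGeometry.Motives.projectiveSpace 3 k).left), (∀ i, (AlgebraicGeometry.Proj.map φ hφ' : (Literature.AlgebraicGeometry.Motives.projectiveSpace 3 k).left ⟶ (AlgebraicGeometry.Proj (MvPolynomial.homogeneousSubmodule (Fin (3 + 1)) O))) (w i) = 𝔰 i (IsLocalRing.closedPoint O)) →
      (∀ i, SplitNodeAt (AlgebraicGeometry.Proj (MvPolynomial.homogeneousSubmodule (Fin (3 + 1)) O)) (projIdealSheaf (MvPolynomial.homogeneousSubmodule (Fin (3 + 1)) O) ⟨Ideal.span (Set.range ![(∑ a, MvPolynomial.C (ct a) * MvPolynomial.X a : MvPolynomial (Fin (3 + 1)) O)]), isHomogeneous_span_of_forall_mem _ _ _ hL⟩) (projIdealSheaf (MvPolynomial.homogeneousSubmodule (Fin (3 + 1)) O) ⟨Ideal.span (Set.range ![(∑ a, MvPolynomial.C (ct a) * MvPolynomial.X a : MvPolynomial (Fin (3 + 1)) O), (MvPolynomial.aeval (fun i : Fin 3 => ∑ j : Fin 3, MvPolynomial.C (Nt i j) * MvPolynomial.X (r j)) Gt : MvPolynomial (Fin (3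 + 1)) O)]), isHomogeneous_span_of_forall_mem _ _ _ hF⟩) (𝔰 i).ker (𝔰 i (IsLocalRing.closedPoint O)))) := by
  intro O _ _ _ _ _ θ hθ
  letI := MvPolynomial.gradedAlgebra (σ := Fin (3 + 1)) (R := O)
  letI := MvPolynomial.gradedAlgebra (σ := Fin (3 + 1)) (R := k)
  intro φ hφ' hφ hPint hPnoeth hPreg hqprop hqsm ℓ Z hZ e δ g B c a b v r hg hsqf hZeq hℓB hr hcab hmarked hcover hvinj a₀ Bt ct Nt ha₀ hBt
    hdet hcta₀ hψt hsect hkert hVℓ Gt nO hGt hGtred hnOv hnO2 hnode hhess hL hF av dv hav hunit 𝔰 h𝔰 w hw i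
  classical
  obtain ⟨u₀, hu₀, huav⟩ := hunit i
  rw [h𝔰 i]
  -- names: the section, its closed point, the chart, the germ map `Θ`
  set S := Spec.map (CommRingCat.ofHom ((Localization.awayLift (MvPolynomial.eval (av i)) (MvPolynomial.X (dv i) : MvPolynomial (Fin (3 + 1)) O)
      (SectionOfVec.isUnit_eval_X (av i) (dv i) (hav i))).comp
      (algebraMap (HomogeneousLocalization.Away (MvPolynomial.homogeneousSubmodule (Fin (3 + 1)) O) (MvPolynomial.X (dv i) : MvPolynomial (Fin (3 + 1)) O))
        (Localization.Away (MvPolynomial.X (dv i) : MvPolynomial (Fin (3 + 1)) O))))) ≫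
    AlgebraicGeometry.Proj.awayι (MvPolynomial.homogeneousSubmodule (Fin (3 + 1)) O) (MvPolynomial.X (dv i)) (MvPolynomial.isHomogeneous_X O (dv i)) one_pos
    with hSdef
  set p := IsLocalRing.closedPoint O with hp
  set U := Proj.basicOpen (homogeneousSubmodule (Fin (3 + 1)) O) (X (dv i) : MvPolynomial (Fin (3 + 1)) O) with hU
  have hx : S p ∈ U := SectionOfVec.sectionOfVec_mem_basicOpen (av i) (dv i) (hav i) p
  haveI := hqprop
  haveI hci : IsClosedImmersion S :=
    Literature.AlgebraicGeometry.Resolution.DeJong1996.IsUnionOfSections.isClosedImmersion_of_comp_eq_id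
      (SectionOfVec.sectionOfVec_comp_eq_id (av i) (dv i) (hav i))
  set Θ : HomogeneousLocalization.Away (homogeneousSubmodule (Fin (3 + 1)) O) (X (dv i) : MvPolynomial (Fin (3 + 1)) O) →+*
      (Proj (homogeneousSubmodule (Fin (3 + 1)) O)).presheaf.stalk (S p) :=
    ((Proj (homogeneousSubmodule (Fin (3 + 1)) O)).presheaf.germ U (S p) hx).hom.comp
      (Proj.awayToSection (homogeneousSubmodule (Fin (3 + 1)) O) (X (dv i) : MvPolynomial (Fin (3 + 1)) O)).hom with hΘ
  -- the linear forms and the key form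
  set Lt : MvPolynomial (Fin (3 + 1)) O := ∑ a, C (ct a) * X a with hLt
  set yt : Fin 3 → MvPolynomial (Fin (3 + 1)) O := fun t => ∑ j : Fin 3, C (Nt t j) * X (r j) with hyt
  have hyt1 : ∀ t, yt t ∈ homogeneousSubmodule (Fin (3 + 1)) O 1 := fun t =>
    (mem_homogeneousSubmodule _ _).mpr (HyperplaneAlg.isHomogeneous_sum_C_mul_X _ _)
  have hLt1 : Lt ∈ homogeneousSubmodule (Fin (3 + 1)) O 1 := (mem_homogeneousSubmodule _ _).mpr (HyperplaneAlg.isHomogeneous_sum_C_mul_X ct id)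
  have hm1 : ∀ t : Fin 3, yt t - C (nO i t) * yt 2 ∈ homogeneousSubmodule (Fin (3 + 1)) O 1 := fun t =>
    (mem_homogeneousSubmodule _ _).mpr ((HyperplaneAlg.isHomogeneous_sum_C_mul_X _ _).sub ((HyperplaneAlg.isHomogeneous_sum_C_mul_X _ _).C_mul _))
  have hGe : aeval yt Gt ∈ homogeneousSubmodule (Fin (3 + 1)) O e := by simpa using hF 1
  -- the scalars and the hyperplane coordinates in the stalk
  set c₀ : O →+* HomogeneousLocalization.Away (homogeneousSubmodule (Fin (3 + 1)) O) (X (dv i) : MvPolynomial (Fin (3 + 1)) O) :=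
    (HomogeneousLocalization.fromZeroRingHom (homogeneousSubmodule (Fin (3 + 1)) O) (Submonoid.powers (X (dv i) : MvPolynomial (Fin (3 + 1)) O))).comp
      (algebraMap O (homogeneousSubmodule (Fin (3 + 1)) O 0)) with hc₀
  set yB : Fin 3 → (Proj (homogeneousSubmodule (Fin (3 + 1)) O)).presheaf.stalk (S p) :=
    fun t => Θ (mk₁ (homogeneousSubmodule (Fin (3 + 1)) O) (isHomogeneous_X O (dv i)) 1 (yt t) (hyt1 t)) with hyB
  -- `y₂/x_d` is a unit at `x`: its image under the LOCAL stalk map of the section is `toStalk (y₂(a))`, a unit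
  have hwB : IsUnit (yB 2) := by
    have hst : (S.stalkMap p) (yB 2) = StructureSheaf.toStalk O p (MvPolynomial.eval (av i) (yt 2)) :=
      SectionOfVec.stalkMap_germ_awayToSection (av i) (dv i) (hav i) p (yt 2) (hyt1 2)
    have hunit2 : IsUnit (MvPolynomial.eval (av i) (yt 2)) := by
      refine IsUnit.of_mul_eq_one_right u₀ ?_
      rw [SectionFrame.mul_eval_sect Bt Nt r (nO i) (av i) u₀ huav hsect 2, hnO2 i]
    have h2 : IsUnit ((S.stalkMap p).hom (yB 2)) := by
      change IsUnit ((S.stalkMap p) (yB 2)); rw [hst]; exact hunit2.map _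
    exact isUnit_of_map_unit (S.stalkMap p).hom _ h2
  -- the node chart data and the Taylor expansion in the stalk
  obtain ⟨h00, h10, h01, hdq⟩ := nodeChart_hypotheses Gt (nO i) (hnO2 i) (hnode i).1 ((hnode i).2 0) ((hnode i).2 1) (hhess i)
  set u := yB 0 - (Θ.comp c₀) (nO i 0) * yB 2 with hudef
  set vv := yB 1 - (Θ.comp c₀) (nO i 1) * yB 2 with hvdef
  obtain ⟨A, Bq, Cq, h, hgeq, hh, hdisc⟩ := SectionOfVec.node_taylor_eval₂ (Θ.comp c₀) Gt hGt (nO i) h00 h10 h01 hdq yB hwB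
  -- `u, v` are the germs of `(y_t − n_t y₂)/x_d`; `g` is the germ of `Ĝ/x_d^e`
  have hum : ∀ t : Fin 3, Θ (mk₁ (homogeneousSubmodule (Fin (3 + 1)) O) (isHomogeneous_X O (dv i)) 1 (yt t - C (nO i t) * yt 2) (hm1 t)) =
      yB t - (Θ.comp c₀) (nO i t) * yB 2 := by
    intro t
    have ha : aeval yt (X t - C (nO i t) * X 2 : MvPolynomial (Fin 3) O) = yt t - C (nO i t) * yt 2 := by
      rw [map_sub, map_mul, aeval_X, aeval_X, aeval_C, MvPolynomial.algebraMap_eq]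
    have hmem : aeval yt (X t - C (nO i t) * X 2 : MvPolynomial (Fin 3) O) ∈ homogeneousSubmodule (Fin (3 + 1)) O 1 := by rw [ha]; exact hm1 t
    rw [← mk₁_congr (homogeneousSubmodule (Fin (3 + 1)) O) (isHomogeneous_X O (dv i)) ha hmem (hm1 t),
      SectionOfVec.mk₁_aeval_linear_eq_eval₂ (dv i) yt hyt1 _ (((isHomogeneous_X O t).sub ((isHomogeneous_X O 2).C_mul _))) hmem,
      MvPolynomial.eval₂_comp_left Θ c₀]
    simp only [eval₂_sub, eval₂_mul, eval₂_X, eval₂_C, Function.comp_apply, hyB]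
  have hgerm : Θ (mk₁ (homogeneousSubmodule (Fin (3 + 1)) O) (isHomogeneous_X O (dv i)) e (aeval yt Gt) hGe) = eval₂ (Θ.comp c₀) yB Gt := by
    rw [SectionOfVec.mk₁_aeval_linear_eq_eval₂ (dv i) yt hyt1 Gt hGt hGe, MvPolynomial.eval₂_comp_left Θ c₀]
    rfl
  -- STALKS OF THE THREE IDEAL SHEAVES through the chart `D₊(x_d)`
  have hrange1 : ∀ (f : Fin 1 → (Proj (homogeneousSubmodule (Fin (3 + 1)) O)).presheaf.stalk (S p)), Ideal.span (Set.range f) = Ideal.span {f 0} := by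
    intro f; congr 1; ext z; constructor
    · rintro ⟨l, rfl⟩; fin_cases l; simp
    · rintro rfl; exact ⟨0, rfl⟩
  have hrange2 : ∀ (f : Fin 2 → (Proj (homogeneousSubmodule (Fin (3 + 1)) O)).presheaf.stalk (S p)),
      Ideal.span (Set.range f) = Ideal.span {f 0} ⊔ Ideal.span {f 1} := by
    intro f; rw [← Ideal.span_union]; congr 1; ext z; constructor
    · rintro ⟨l, rfl⟩; fin_cases l <;> simp
    · rintro (rfl | rfl) <;> exact ⟨_, rfl⟩
  have hrange3 : ∀ (f : Fin 3 → (Proj (homogeneousSubmodule (Fin (3 + 1)) O)).presheaf.stalk (S p)),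
      Ideal.span (Set.range f) = Ideal.span {f 0} ⊔ Ideal.span {f 1, f 2} := by
    intro f; rw [← Ideal.span_union]; congr 1; ext z; constructor
    · rintro ⟨l, rfl⟩; fin_cases l <;> simp
    · rintro (rfl | rfl | rfl) <;> exact ⟨_, rfl⟩
  -- (1) the kernel stalk
  have hFr : ∀ l, (![Lt, yt 0 - C (nO i 0) * yt 2, yt 1 - C (nO i 1) * yt 2] : Fin 3 → MvPolynomial (Fin (3 + 1)) O) l ∈
      homogeneousSubmodule (Fin (3 + 1)) O ((fun _ => 1 : Fin 3 → ℕ) l) := by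
    intro l; fin_cases l
    · exact hLt1
    · exact hm1 0
    · exact hm1 1
  have hfr := SectionFrame.span_X_sub_eq_span_frame Bt ct Nt r a₀ hcta₀ hψt hsect hkert (nO i) (hnO2 i) (av i) (dv i) (hav i) u₀ hu₀ huav
  have hK : stalkIdeal S.ker (S p) = stalkIdeal (projIdealSheaf (homogeneousSubmodule (Fin (3 + 1)) O)
      ⟨Ideal.span (Set.range ![Lt]), isHomogeneous_span_of_forall_mem _ _ _ hL⟩) (S p) ⊔ Ideal.span {u, vv} := by
    rw [SectionOfVec.stalkIdeal_ker_sectionOfVec_eq (av i) (dv i) (hav i) hci]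
    have hN : (⟨Ideal.span (Set.range fun j : Fin (3 + 1) => (X j - C (av i j) * X (dv i) : MvPolynomial (Fin (3 + 1)) O)),
        isHomogeneous_span_of_forall_mem _ _ (fun _ => 1) (SectionOfVec.X_sub_C_mul_X_mem_one (av i) (dv i))⟩ :
          HomogeneousIdeal (homogeneousSubmodule (Fin (3 + 1)) O)) =
        ⟨Ideal.span (Set.range ![Lt, yt 0 - C (nO i 0) * yt 2, yt 1 - C (nO i 1) * yt 2]), isHomogeneous_span_of_forall_mem _ _ (fun _ => 1) hFr⟩ :=
      HomogeneousIdeal.ext hfr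
    rw [hN, CILift.stalkIdeal_projIdealSheaf_span _ (fun _ => 1) hFr (dv i) (S p) hx,
      CILift.stalkIdeal_projIdealSheaf_span _ _ hL (dv i) (S p) hx, hrange3, hrange1]
    have e0 : mk₁ (homogeneousSubmodule (Fin (3 + 1)) O) (isHomogeneous_X O (dv i)) 1
        ((![Lt, yt 0 - C (nO i 0) * yt 2, yt 1 - C (nO i 1) * yt 2] : Fin 3 → MvPolynomial (Fin (3 + 1)) O) 0) (hFr 0) =
        mk₁ (homogeneousSubmodule (Fin (3 + 1)) O) (isHomogeneous_X O (dv i)) ((![1] : Fin 1 → ℕ) 0)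
          ((![Lt] : Fin 1 → MvPolynomial (Fin (3 + 1)) O) 0) (hL 0) := rfl
    have e1 : mk₁ (homogeneousSubmodule (Fin (3 + 1)) O) (isHomogeneous_X O (dv i)) 1
        ((![Lt, yt 0 - C (nO i 0) * yt 2, yt 1 - C (nO i 1) * yt 2] : Fin 3 → MvPolynomial (Fin (3 + 1)) O) 1) (hFr 1) =
        mk₁ (homogeneousSubmodule (Fin (3 + 1)) O) (isHomogeneous_X O (dv i)) 1 (yt 0 - C (nO i 0) * yt 2) (hm1 0) :=
      mk₁_congr _ _ (by simp) _ _
    have e2 : mk₁ (homogeneousSubmodule (Fin (3 + 1)) O) (isHomogeneous_X O (dv i)) 1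
        ((![Lt, yt 0 - C (nO i 0) * yt 2, yt 1 - C (nO i 1) * yt 2] : Fin 3 → MvPolynomial (Fin (3 + 1)) O) 2) (hFr 2) =
        mk₁ (homogeneousSubmodule (Fin (3 + 1)) O) (isHomogeneous_X O (dv i)) 1 (yt 1 - C (nO i 1) * yt 2) (hm1 1) :=
      mk₁_congr _ _ (by simp) _ _
    rw [e0, e1, e2, hudef, hvdef, ← hum 0, ← hum 1]
    rfl
  -- (2) the nose stalk
  have hW : stalkIdeal (projIdealSheaf (homogeneousSubmodule (Fin (3 + 1)) O)
      ⟨Ideal.span (Set.range ![Lt, aeval yt Gt]), isHomogeneous_span_of_forall_mem _ _ _ hF⟩) (S p) =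
      stalkIdeal (projIdealSheaf (homogeneousSubmodule (Fin (3 + 1)) O)
        ⟨Ideal.span (Set.range ![Lt]), isHomogeneous_span_of_forall_mem _ _ _ hL⟩) (S p) ⊔
      Ideal.span {Θ (mk₁ (homogeneousSubmodule (Fin (3 + 1)) O) (isHomogeneous_X O (dv i)) e (aeval yt Gt) hGe)} := by
    rw [CILift.stalkIdeal_projIdealSheaf_span _ _ hF (dv i) (S p) hx, CILift.stalkIdeal_projIdealSheaf_span _ _ hL (dv i) (S p) hx,
      hrange2, hrange1]
    have eW0 : mk₁ (homogeneousSubmodule (Fin (3 + 1)) O) (isHomogeneous_X O (dv i)) ((![1, e] : Fin 2 → ℕ) 0)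
        ((![Lt, aeval yt Gt] : Fin 2 → MvPolynomial (Fin (3 + 1)) O) 0) (hF 0) =
        mk₁ (homogeneousSubmodule (Fin (3 + 1)) O) (isHomogeneous_X O (dv i)) ((![1] : Fin 1 → ℕ) 0)
          ((![Lt] : Fin 1 → MvPolynomial (Fin (3 + 1)) O) 0) (hL 0) := rfl
    have eW1 : mk₁ (homogeneousSubmodule (Fin (3 + 1)) O) (isHomogeneous_X O (dv i)) ((![1, e] : Fin 2 → ℕ) 1)
        ((![Lt, aeval yt Gt] : Fin 2 → MvPolynomial (Fin (3 + 1)) O) 1) (hF 1) =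
        mk₁ (homogeneousSubmodule (Fin (3 + 1)) O) (isHomogeneous_X O (dv i)) e (aeval yt Gt) hGe :=
      SectionOfVec.mk₁_congr₂ (dv i) (by simp) (by simp) _ _
    rw [eW0, eW1]
    rfl
  -- (3)–(5) the node along the section
  unfold SplitNodeAt
  refine ⟨u, vv, Θ (mk₁ (homogeneousSubmodule (Fin (3 + 1)) O) (isHomogeneous_X O (dv i)) e (aeval yt Gt) hGe), A, Bq, Cq, h,
    hK, hW, ?_, ?_, hdisc⟩
  · rw [hgerm, hgeq, hudef, hvdef]
  · rw [hudef, hvdef]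
    exact Ideal.mem_sup_right hh

end Summit.ResolutionOfSingularities.ResolutionOfSingularities.Cruxes.EquisingularLiftNat.Sections.Equinodal

end
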